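import Literature.NumberTheory.EllipticCurves.TowerLiftableOfDualityProofs
import Literature.NumberTheory.EllipticCurves.TowerSaturatedCartesianPresentedProofs
import Mathlib.Order.WellFounded
import HarnessLib

/-!
# The limit pairing of two towers is perfect modulo torsion when the level pairings are
# (theorems only; no definition, no named fact, no instance, no `sorry`)

`Proofs` file in the currency of the tree's abstract towers `Literature.NumberTheory.EllipticCurves.Tower.*`;
companion of `TowerSaturatedAnnihilatorProofs` (H.4 descent), `TowerLiftableOfDualityProofs` ((Dual)) and
`Literature/Algebra/Module/PairingSaturatedAnnihilatorPID` (the limit statement (Exact), which asks that the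
LIMIT pairing `lim X_j × lim Y_j → lim Q_j` have torsion kernels and adjoints onto the duals).  For the local
cohomology towers `X_j = H¹(K_v, T/p^j)`, `Y_j = H¹(K_v̄, T/p^j)` these two properties of
`H¹(K_v, T) × H¹(K_v̄, T) → R` are local Tate duality «in the limit»; this file derives them ABSTRACTLY from the
finite levels (cell `pub/bsd-print-x9`, memo `HOME/p1/H4-AT-P-PLAN` (A3)):

* §1 in a tower of finite groups the images `red^{(d)} (X_{k+d}) ⊆ X_k` stabilise, and the stable image is the
  group of liftable classes (`exists_range_redIter_le_levelCondition_top`, with Kőnig);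
* §2 **a class orthogonal to all LIFTABLE classes is a Kummer class** (`mem_levelCondition_bot_of_forall_pairing
  _top_eq_zero`) — the mirror image of (Dual): from the projection formula (Adj′) `ι_d (B_k (red^{(d)} w, y)) =
  B_{k+d} (w, up′_d y)`, right non-degeneracy of `B_{k+d}` and `ker up′_d ⊆` bottom condition;
* §3 **the right kernel of the limit pairing is torsion** (`pow_smul_eq_zero_of_forall_pairing_eq_zero`): a
  compatible family of `Y` pairing to zero with every compatible family of `X` at every level is killed by `p^c`,
  `c` a bound for the exponent of the torsion compatible families of `Y` (finitely generated limit);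
* §4 **the adjoint is onto**: a reduction-compatible family of level functionals `g_k : X_k → Q_k`, each
  represented on the liftable classes by some element of `Y_k` (finite-level perfectness), is represented by ONE
  compatible family of `Y` (`exists_mem_compatibleFamilies_forall_pairing_eq`, Kőnig in the constraint form of
  `TowerSaturatedCartesianPresentedProofs`).

Nothing arithmetic is proved here; no summit statement is proved; BSD is not proved by any of this.

References: J. S. Milne, *Arithmetic Duality Theorems* (2006), I §0 Prop. 0.19, I Cor. 2.3 and its proof (local
duality for finitely generated modules by passage to the limit over finite quotients); J.-P. Serre, *Galois
Cohomology* (1997), I §2.2 (limits of finite modules, compactness); B. Howard, Compositio Math. 140 (2004), H.4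
and Def. 3.2.6 (arXiv:1202.6340 p. 7 L78–82, p. 16); B. Mazur, K. Rubin, Mem. AMS 799 (2004), §1.3.
-/

noncomputable section

universe u v w

namespace Literature.NumberTheory.EllipticCurves

namespace Tower

section Stabilise

variable {H : ℕ → Type u} [∀ j, AddCommGroup (H j)] (red : ∀ j, H (j + 1) →+ H j)

/-! ## §1 The images of the iterated reductions stabilise at the liftable classes -/

/-- The images `red^{(d)} (H_{k+d}) ⊆ H_k` decrease with `d`. [cite: SerreGaloisCohomology1997, Ch. I §2.2] -/
theorem range_redIter_succ_le (k d : ℕ) :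
    (redIter red k (d + 1)).range ≤ (redIter red k d).range := by
  rintro _ ⟨y, rfl⟩
  rw [redIter_succ]
  exact ⟨_, rfl⟩

/-- The images `red^{(d)} (H_{k+d}) ⊆ H_k` form an antitone sequence. [cite: SerreGaloisCohomology1997, Ch. I §2.2] -/
theorem range_redIter_antitone (k : ℕ) {d d' : ℕ} (h : d ≤ d') :
    (redIter red k d').range ≤ (redIter red k d).range := by
  obtain ⟨e, rfl⟩ := Nat.exists_eq_add_of_le h
  induction e with
  | zero => exact le_rfl
  | succ e ih =>
    exact (range_redIter_succ_le red k (d + e)).trans (ih (Nat.le_add_right d e))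

/-- **In a finite group the images of the iterated reductions stabilise**: some `red^{(d₀)} (H_{k+d₀})` is
contained in (hence equal to) every later image. [cite: SerreGaloisCohomology1997, Ch. I §2.2 (Mittag-Leffler for finite groups)] -/
theorem exists_range_redIter_stable (k : ℕ) [Finite (H k)] :
    ∃ d₀ : ℕ, ∀ d, d₀ ≤ d → (redIter red k d).range = (redIter red k d₀).range := by
  classical
  let f : ℕ → ℕ := fun d ↦ Nat.card (redIter red k d).range
  refine ⟨Function.argmin f, fun d hd ↦ ?_⟩
  refine AddSubgroup.eq_of_le_of_card_ge (range_redIter_antitone red k hd) ?_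
  exact not_lt.1 (Function.not_lt_argmin f d)

/-- **The stable image consists of liftable classes** (tower of finite groups): for a suitable `d₀`, every
class in `red^{(d₀)} (H_{k+d₀})` lies in every `red^{(d)} (H_{k+d})`, hence (Kőnig) in the top condition
`levelCondition red p ⊤ k`. [cite: SerreGaloisCohomology1997, Ch. I §2.2] [cite: NeukirchSchmidtWingberg2008, Cor. 2.7.6] -/
theorem exists_range_redIter_le_levelCondition_top [∀ j, Finite (H j)] (p : ℕ) (k : ℕ) :
    ∃ d₀ : ℕ, (redIter red k d₀).range ≤ levelCondition red p (fun _ ↦ (⊤ : AddSubgroup (H _))) k := by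
  obtain ⟨d₀, hd₀⟩ := exists_range_redIter_stable red k
  refine ⟨d₀, fun y hy ↦ mem_levelCondition_top_of_forall_mem_range red p k y fun d ↦ ?_⟩
  by_cases hd : d₀ ≤ d
  · rwa [hd₀ d hd]
  · exact range_redIter_antitone red k (le_of_not_ge hd) hy

end Stabilise

section Pairing

variable {X : ℕ → Type u} [∀ j, AddCommGroup (X j)] (red : ∀ j, X (j + 1) →+ X j)
variable {Y : ℕ → Type v} [∀ j, AddCommGroup (Y j)] (red' : ∀ j, Y (j + 1) →+ Y j)
variable {Q : ℕ → Type w} [∀ j, AddCommGroup (Q j)] (B : ∀ j, X j →+ Y j →+ Q j)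

/-! ## §2 A class orthogonal to the liftable classes is a Kummer class -/

/-- **Orthogonal to all liftable classes ⇒ in the bottom condition** (the mirror image of (Dual)).  At a level
`k`, suppose: (Adj′) `ι_d (B_k (red^{(d)} w, y)) = B_{k+d} (w, up′_d y)` for level maps `up′_d : Y_k → Y_{k+d}`
and value comparisons `ι_d`; (Nondeg′) `B_{k+d} (·, y′) = 0 ⇒ y′ = 0`; (Ker′) `ker up′_d` lies in the bottom
condition of `Y`.  Then a class `y ∈ Y_k` with `B_k (x, y) = 0` for every LIFTABLE `x` lies in
`levelCondition red′ p ⊥ k`: the liftable classes contain a stable image `red^{(d₀)} (X_{k+d₀})` (§1), so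
`up′_{d₀} y = 0`.  For `H¹(K_v, T/p^k)`: «the annihilator of the image of `H¹(K_v̄, T)` is the image of
`H¹(K_v, T)_tors` (the Kummer classes)». [cite: MilneADT2006, Ch. I §0 Prop. 0.19 and Cor. 2.3]
[cite: Howard2004HeegnerKolyvagin, H.4 (arXiv p. 7, L78–82)] -/
theorem mem_levelCondition_bot_of_forall_pairing_top_eq_zero [∀ j, Finite (X j)] (p : ℕ) (k : ℕ)
    (up' : ∀ d : ℕ, Y k →+ Y (k + d)) (incQ : ∀ d : ℕ, Q k →+ Q (k + d))
    (hAdj : ∀ (d : ℕ) (w : X (k + d)) (y : Y k),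
      incQ d (B k (redIter red k d w) y) = B (k + d) w (up' d y))
    (hNondeg : ∀ (d : ℕ) (y' : Y (k + d)), (∀ w : X (k + d), B (k + d) w y' = 0) → y' = 0)
    (hKer : ∀ (d : ℕ) (y : Y k), up' d y = 0 →
      y ∈ levelCondition red' p (fun _ ↦ (⊥ : AddSubgroup (Y _))) k)
    (y : Y k) (hy : ∀ x ∈ levelCondition red p (fun _ ↦ (⊤ : AddSubgroup (X _))) k, B k x y = 0) :
    y ∈ levelCondition red' p (fun _ ↦ (⊥ : AddSubgroup (Y _))) k := by
  obtain ⟨d₀, hd₀⟩ := exists_range_redIter_le_levelCondition_top red p k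
  refine hKer d₀ y (hNondeg d₀ (up' d₀ y) fun w ↦ ?_)
  rw [← hAdj, hy _ (hd₀ ⟨w, rfl⟩), map_zero]

/-! ## §3 The right kernel of the limit pairing is torsion -/

/-- **The right kernel of the limit pairing is torsion.**  If at every level the inputs (Adj′), (Nondeg′),
(Ker′) of §2 hold and the torsion compatible families of `Y` have bounded exponent `p^c` (true for a
finitely generated limit), then a family `y` of `Y` (compatible or not) pairing to zero with every compatible family of `X` at
every level is killed by `p^c`. [cite: MilneADT2006, Ch. I Cor. 2.3 (local duality for finitely generated modules)]
[cite: SerreGaloisCohomology1997, Ch. I §2.2] -/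
theorem pow_smul_eq_zero_of_forall_pairing_eq_zero [∀ j, Finite (X j)] (p : ℕ)
    (up' : ∀ k d : ℕ, Y k →+ Y (k + d)) (incQ : ∀ k d : ℕ, Q k →+ Q (k + d))
    (hAdj : ∀ (k d : ℕ) (w : X (k + d)) (y : Y k),
      incQ k d (B k (redIter red k d w) y) = B (k + d) w (up' k d y))
    (hNondeg : ∀ (k d : ℕ) (y' : Y (k + d)), (∀ w : X (k + d), B (k + d) w y' = 0) → y' = 0)
    (hKer : ∀ (k d : ℕ) (y : Y k), up' k d y = 0 →
      y ∈ levelCondition red' p (fun _ ↦ (⊥ : AddSubgroup (Y _))) k)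
    {c : ℕ} (hc : ∀ η ∈ compatibleFamilies red', (∃ b : ℕ, p ^ b • η = 0) → p ^ c • η = 0)
    (y : Π j, Y j) (h0 : ∀ (k : ℕ), ∀ x ∈ compatibleFamilies red, B k (x k) (y k) = 0) :
    p ^ c • y = 0 := by
  funext k
  rw [Pi.smul_apply, Pi.zero_apply]
  have hyk : y k ∈ levelCondition red' p (fun _ ↦ (⊥ : AddSubgroup (Y _))) k :=
    mem_levelCondition_bot_of_forall_pairing_top_eq_zero red red' B p k (up' k) (incQ k) (hAdj k)
      (hNondeg k) (hKer k) (y k) fun x hx ↦ by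
        obtain ⟨ξ, hξ, rfl⟩ := (mem_levelCondition_top_iff red p k x).1 hx
        exact h0 k ξ hξ
  obtain ⟨η, hη, hb, hηk⟩ := (mem_levelCondition_bot_iff red' p k (y k)).1 hyk
  have hη0 := congrFun (hc η hη hb) k
  rw [Pi.smul_apply, Pi.zero_apply, hηk] at hη0
  exact hη0

/-! ## §4 The adjoint of the limit pairing is onto: compatible functionals are represented -/

/-- **Compatible level functionals are represented by a compatible family** (tower `Y` of finite groups).  If
the level pairings are reduction-compatible into a value tower (`redQ (B_{j+1} (x, y)) = B_j (red x, red′ y)`),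
every level functional `g_k : X_k → Q_k` is represented on the LIFTABLE classes by some element of `Y_k`
(finite-level perfectness), and the `g_k` are compatible on compatible families (`redQ (g_{k+1} x_{k+1}) =
g_k x_k`), then ONE compatible family `y` of `Y` represents them all: `B_k (x_k, y_k) = g_k (x_k)` for every
compatible `x` and every `k` — the sets of level representatives form an inverse system of nonempty finite sets
(Kőnig, `exists_mem_compatibleFamilies_of_forall_mem`).  This is the surjectivity of `lim Y_j → Hom(lim X_j, lim Q_j)`
onto the continuous functionals. [cite: MilneADT2006, Ch. I §0 Prop. 0.19 and Cor. 2.3]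
[cite: SerreGaloisCohomology1997, Ch. I §2.2 (compactness)] [cite: NeukirchSchmidtWingberg2008, Cor. 2.7.6] -/
theorem exists_mem_compatibleFamilies_forall_pairing_eq [∀ j, Finite (Y j)] (p : ℕ)
    (redQ : ∀ j, Q (j + 1) →+ Q j)
    (hB : ∀ j (x : X (j + 1)) (y : Y (j + 1)), redQ j (B (j + 1) x y) = B j (red j x) (red' j y))
    (g : ∀ k, X k →+ Q k)
    (hg : ∀ (k : ℕ), ∀ x ∈ compatibleFamilies red, redQ k (g (k + 1) (x (k + 1))) = g k (x k))
    (hrep : ∀ k, ∃ y : Y k, ∀ x ∈ levelCondition red p (fun _ ↦ (⊤ : AddSubgroup (X _))) k,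
      B k x y = g k x) :
    ∃ y ∈ compatibleFamilies red', ∀ (k : ℕ), ∀ x ∈ compatibleFamilies red, B k (x k) (y k) = g k (x k) := by
  obtain ⟨y, hy, hyS⟩ := exists_mem_compatibleFamilies_of_forall_mem red'
    (fun k ↦ {y : Y k | ∀ x ∈ compatibleFamilies red, B k (x k) y = g k (x k)})
    (fun k ↦ by
      obtain ⟨y, hy⟩ := hrep k
      exact ⟨y, fun x hx ↦ hy (x k) ((mem_levelCondition_top_iff red p k (x k)).2 ⟨x, hx, rfl⟩)⟩)
    (fun k y hy x hx ↦ by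
      have hxk : red k (x (k + 1)) = x k := (mem_compatibleFamilies_iff red x).1 hx k
      rw [← hxk, ← hB, hy x hx, hg k x hx, hxk])
  exact ⟨y, hy, fun k x hx ↦ hyS k x hx⟩

/-- **Compatible level functionals are represented by a compatible family — functional form.**  The same as
`exists_mem_compatibleFamilies_forall_pairing_eq` with the level functionals `g_k : X_k → Q_k` arbitrary FUNCTIONS
(only their values on the liftable classes matter, and additivity is never used): this is the form met when
`g_k` is «`Ψ(x) mod 𝔪^{e_k}` for any lift `x` of `x_k`», defined arbitrarily off the liftable classes.
[cite: MilneADT2006, Ch. I §0 Prop. 0.19 and Cor. 2.3] [cite: SerreGaloisCohomology1997, Ch. I §2.2 (compactness)] -/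
theorem exists_mem_compatibleFamilies_forall_pairing_eq_fun [∀ j, Finite (Y j)] (p : ℕ)
    (redQ : ∀ j, Q (j + 1) →+ Q j)
    (hB : ∀ j (x : X (j + 1)) (y : Y (j + 1)), redQ j (B (j + 1) x y) = B j (red j x) (red' j y))
    (g : ∀ k, X k → Q k)
    (hg : ∀ (k : ℕ), ∀ x ∈ compatibleFamilies red, redQ k (g (k + 1) (x (k + 1))) = g k (x k))
    (hrep : ∀ k, ∃ y : Y k, ∀ x ∈ levelCondition red p (fun _ ↦ (⊤ : AddSubgroup (X _))) k,
      B k x y = g k x) :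
    ∃ y ∈ compatibleFamilies red', ∀ (k : ℕ), ∀ x ∈ compatibleFamilies red, B k (x k) (y k) = g k (x k) := by
  obtain ⟨y, hy, hyS⟩ := exists_mem_compatibleFamilies_of_forall_mem red'
    (fun k ↦ {y : Y k | ∀ x ∈ compatibleFamilies red, B k (x k) y = g k (x k)})
    (fun k ↦ by
      obtain ⟨y, hy⟩ := hrep k
      exact ⟨y, fun x hx ↦ hy (x k) ((mem_levelCondition_top_iff red p k (x k)).2 ⟨x, hx, rfl⟩)⟩)
    (fun k y hy x hx ↦ by
      have hxk : red k (x (k + 1)) = x k := (mem_compatibleFamilies_iff red x).1 hx k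
      rw [← hxk, ← hB, hy x hx, hg k x hx, hxk])
  exact ⟨y, hy, fun k x hx ↦ hyS k x hx⟩

/-- **Representability on the liftable classes from representability on the whole level** — the form in
which finite-level perfectness (every additive `X_k → Q_k` is `B_k (·, y)`, e.g. `X_k` finite `n`-torsion and
`Q_k ≅ ℤ/n` with injective adjoints) feeds `hrep` above, for a level functional given on all of `X_k`.
[cite: MilneADT2006, Ch. I §0 Prop. 0.19] -/
theorem exists_forall_levelCondition_top_pairing_eq_of_surjective (p : ℕ) (k : ℕ)
    (hsurj : ∀ f : X k →+ Q k, ∃ y : Y k, ∀ x : X k, B k x y = f x) (f : X k →+ Q k) :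
    ∃ y : Y k, ∀ x ∈ levelCondition red p (fun _ ↦ (⊤ : AddSubgroup (X _))) k, B k x y = f x := by
  obtain ⟨y, hy⟩ := hsurj f
  exact ⟨y, fun x _ ↦ hy x⟩

end Pairing

end Tower

end Literature.NumberTheory.EllipticCurves

end
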